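import Literature.AlgebraicGeometry.HodgeTheory.IsogenyCategorySemisimple
import Literature.Geometry.Kaehler.ComplexTorusSubtorusQuotientHomology
import Literature.Geometry.Kaehler.ComplexTorusSimpleEndomorphismAlgebra
import HarnessLib

/-!
# Kernels, cokernels and short exact sequences in the isogeny category of complex tori are the
# sub- and quotient tori: `Ker(f) = (Ker f)⁰`, `Coker(f) = X′/Im f`; mono ⟺ finite kernel, epi ⟺
# surjective; the simple objects are the simple tori

Layer `Literature/AlgebraicGeometry/HodgeTheory`, namespace `Literature.AlgebraicGeometry.HodgeTheory.TorusIsogenyCat`;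
lane `lit-hodgefound` (Track 2 foundations library, Layer A1/A2), prover seat `lit-hodgefound-p35` (gen 6) —
sequel of the seat's `IsogenyCategoryWeightOneHodgeEquivalence` (Q390: the category, `H¹`),
`IsogenyCategoryAbelian` (the isogeny category is ABELIAN, abstractly, through Riemann's equivalence) and
`IsogenyCategorySemisimple` (Isab: simple objects = simple abelian varieties). This file makes the
abelian structure CONCRETE, joining it to the subtorus and quotient-torus records of Layer A1
(`Geometry/Kaehler/ComplexTorusSubtorusQuotient`, `…SubtorusQuotientHomology`, p15):

* (Lange, §1.1.2 Prop. 1.1.10 / §1.4.1 Prop. 1.4.2 and its proof, p. 43) for a complex subtorus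
  `Y = Φ(W)/(Λ ∩ W)` of `X`, `W = N ⊗ ℝ` the real span of a rational subspace `N ⊆ Λ ⊗ ℚ = H₁(X, ℚ)`
  with `Φ(W)` a complex subspace, the embedding `ι_W = ρ(C) : Y ↪ X` and the projection
  `p_W = ρ(Q) : X ↠ X/Y` have rational representations `C`, `Q` with `R C = 1`, `Q S = 1`,
  `C R + S Q = 1`, `Q C = 0`, `im C_ℚ = N = ker Q_ℚ` ("as a sequence of free abelian groups it splits");
* (Prop. 1.1.10 (b), Prop. 1.2.6: "`f` is an isogeny iff it is surjective with finite kernel"; Milne,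
  *Abelian Varieties* §8: in the isogeny category "every homomorphism with finite kernel and cokernel
  becomes an isomorphism"): in the isogeny category a morphism `f` is a MONOMORPHISM iff its rational
  representation `ρ_r(f) : Λ ⊗ ℚ → Λ′ ⊗ ℚ` is injective (finite kernel), an EPIMORPHISM iff `ρ_r(f)` is
  surjective (`f` surjective), and its kernel and cokernel objects are the identity component
  `(Ker f)⁰ = Φ(ker ρ_r(f) ⊗ ℝ)/…` and the quotient torus `X′/Im f`;
* (§2.4.4 p. 123 "simple"; Birkenhake–Lange §1.1 Exercise (2)(a)) `X` is a SIMPLE OBJECT of the isogeny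
  category iff it is a simple torus (`ComplexTorus.IsSimple`: no complex subtorus other than `0`, `X`) —
  for ALL complex tori, not only abelian varieties (cf. `IsogenyCategorySemisimple`,
  `Isab.simple_iff_isSimple`, which is recovered: `Isab.simple_iff_simple_obj`).

## Contents (definitions with bodies, instances, theorems; NO named fact)

* §0 matrix preliminaries (private).
* §1 SUB- AND QUOTIENT OBJECTS: for `X : TorusIsogenyCat`, `N : Submodule ℚ (X.ι → ℚ)` with
  `hNc : IsComplexSubspace X.Φ (realSpan N)`: `subObj X N hNc` (the subtorus `Y_N`), `subIncl` (`ι = ρ(C)`,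
  `Mono`), `quotObj` (`X/Y_N`), `quotProj` (`p = ρ(Q)`, `Epi`), `subIncl_comp_quotProj` (`p ι = 0`),
  `card_subObj_ι` (`rk = dim_ℚ N`).
* §2 KERNELS AND COKERNELS: `subtorusMatrix_mul_retractionMatrix_mul_eq` (`C R g = g` when `im g ⊆ N`),
  `retractionMatrix_mul_mem_homRat` (`R g ∈ Hom_ℚ(Z, Y_N)`), **`isLimitKernelForkOfKerEq`** (`Y_N ↪ X` is
  the kernel of every `f` with `ker ρ_r(f) = N`), `isComplexSubspace_realSpan_ker` / `_range`, `kerObj f`,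
  `kerIncl f`, **`kernelIsoKerObj f : kernel f ≅ kerObj f`**; dually `mul_sectionMatrix_mul_quotientTorusMatrix_eq`,
  `mul_sectionMatrix_mem_homRat`, **`isColimitCokernelCoforkOfRangeEq`**, `cokerObj f`, `cokerProj f`,
  **`cokernelIsoCokerObj f : cokernel f ≅ cokerObj f`**; **`subQuotShortExact`**: `0 → Y_N → X → X/Y_N → 0`
  is a short exact sequence of the abelian category `TorusIsogenyCat`.
* §3 MONO / EPI: **`mono_iff_ker_eq_bot`** (`Mono f ↔ ker ρ_r(f) = 0`), **`epi_iff_range_eq_top`**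
  (`Epi f ↔ im ρ_r(f) = Λ′ ⊗ ℚ`), `isZero_iff_isEmpty`.
* §4 SIMPLE OBJECTS = SIMPLE TORI: `subIncl_ne_zero`, `isSimple_of_simple`, `simple_of_isSimple`,
  **`simple_iff_isSimple (X) [Nonempty X.ι] : Simple X ↔ IsSimple X.Φ`**, **`Isab.simple_iff_simple_obj`**.
* §5 VALIDATION: elliptic curves are simple objects of `TorusIsogenyCat`; `E × E′` is not; the first
  inclusion `E ↪ E × E′` is a monomorphism which is not an epimorphism.

## References

* [Lange2023AbelianVarietiesComplex] H. Lange, *Abelian Varieties over the Complex Numbers*, Grundlehren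
  Text Edition, Springer (2023), §1.1.2 Prop. 1.1.6, Prop. 1.1.10, Lemma 1.1.11; §1.2.6; §1.4.1 Prop. 1.4.2
  (p. 43); §2.4.4 (p. 123).
* [LangeBirkenhake1992] H. Lange, Ch. Birkenhake, *Complex Abelian Varieties* (1992), §1.1 Exercise (2)(a),
  §1.2 (isogenies).
* [MilneAV2008] J. S. Milne, *Abelian Varieties* (v2.0, 2008), §8 "The category of abelian varieties up
  to isogeny" (`AV⁰(k)` is abelian; kernels and cokernels).
* [MumfordAV1970] D. Mumford, *Abelian Varieties* (1970), §19 (the category of abelian varieties up to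
  isogeny), pp. 172–174.
-/

noncomputable section

-- Nested instance problems on the carriers `↥(rationalForms Φ 1)`, cf. `IsogenyCategoryWeightOneHodgeEquivalence`.
set_option maxSynthPendingDepth 3

open CategoryTheory CategoryTheory.Limits Opposite Module Function
open scoped Matrix

namespace Literature.AlgebraicGeometry.HodgeTheory

open Literature.Geometry.Kaehler Literature.Geometry.Kaehler.ComplexTorus

/-! ## §0 Matrix preliminaries -/

section Prelim

/-- `(M N) ⊗ ℝ = (M ⊗ ℝ)(N ⊗ ℝ)` for rational matrices. [folklore] -/
private theorem map_ratCast_mul' {l m n : Type*} [Fintype m] (M : Matrix l m ℚ) (N : Matrix m n ℚ) :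
    (M * N).map (Rat.cast : ℚ → ℝ) = M.map (Rat.cast : ℚ → ℝ) * N.map (Rat.cast : ℚ → ℝ) :=
  Matrix.map_mul (f := Rat.castHom ℝ)

/-- `1 ⊗ ℝ = 1`. [folklore] -/
private theorem map_ratCast_one' {n : Type*} [DecidableEq n] : (1 : Matrix n n ℚ).map (Rat.cast : ℚ → ℝ) = 1 :=
  Matrix.map_one _ Rat.cast_zero Rat.cast_one

/-- `(M N) ⊗ ℚ = (M ⊗ ℚ)(N ⊗ ℚ)` for integer matrices. [folklore] -/
private theorem map_intCast_mul' {l m n : Type*} [Fintype m] (M : Matrix l m ℤ) (N : Matrix m n ℤ) :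
    (M * N).map (Int.cast : ℤ → ℚ) = M.map (Int.cast : ℤ → ℚ) * N.map (Int.cast : ℤ → ℚ) :=
  Matrix.map_mul (f := Int.castRingHom ℚ)

/-- Two matrices acting equally on all vectors are equal. [folklore] -/
private theorem eq_of_mulVec_eq {m n : Type*} [Fintype n] [DecidableEq n] {A B : Matrix m n ℚ}
    (h : ∀ v, A *ᵥ v = B *ᵥ v) : A = B :=
  Matrix.toLin'.injective (LinearMap.ext fun v ↦ by rw [Matrix.toLin'_apply, Matrix.toLin'_apply, h v])

end Prelim

section SubQuotMatrices

variable {ι : Type*} [Fintype ι] [DecidableEq ι] (W : Submodule ℝ (ι → ℝ))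

/-- **`C R + S Q = 1` over `ℚ`** (the splitting `Λ ⊗ ℚ = (W ∩ Λ) ⊗ ℚ ⊕ S(Λ″ ⊗ ℚ)`).
[cite: Lange2023AbelianVarietiesComplex, §1.4.1 Prop. 1.4.2 (proof), p. 43] -/
theorem _root_.Literature.Geometry.Kaehler.ComplexTorus.subtorusMatrix_mul_add_sectionMatrix_mul_rat :
    (subtorusMatrix W).map (Int.cast : ℤ → ℚ) * (retractionMatrix W).map (Int.cast : ℤ → ℚ) +
      (sectionMatrix W).map (Int.cast : ℤ → ℚ) * (quotientTorusMatrix W).map (Int.cast : ℤ → ℚ) = 1 := by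
  have h := congrArg (fun M : Matrix ι ι ℤ ↦ M.map (Int.cast : ℤ → ℚ)) (subtorusMatrix_mul_add_sectionMatrix_mul W)
  rwa [Matrix.map_add _ Int.cast_add, Matrix.map_one _ Int.cast_zero Int.cast_one, map_intCast_mul',
    map_intCast_mul'] at h

/-- `S Q = 1 - C R` over `ℚ`. [cite: Lange2023AbelianVarietiesComplex, §1.4.1 Prop. 1.4.2 (proof), p. 43] -/
theorem _root_.Literature.Geometry.Kaehler.ComplexTorus.sectionMatrix_mul_quotientTorusMatrix_rat :
    (sectionMatrix W).map (Int.cast : ℤ → ℚ) * (quotientTorusMatrix W).map (Int.cast : ℤ → ℚ) =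
      1 - (subtorusMatrix W).map (Int.cast : ℤ → ℚ) * (retractionMatrix W).map (Int.cast : ℤ → ℚ) :=
  eq_sub_of_add_eq' (subtorusMatrix_mul_add_sectionMatrix_mul_rat W)

end SubQuotMatrices

namespace TorusIsogenyCat

/-! ## §1 Subtori and quotient tori as sub- and quotient objects -/

section SubQuot

variable (X : TorusIsogenyCat) (N : Submodule ℚ (X.ι → ℚ)) (hNc : IsComplexSubspace X.Φ (realSpan N))

/-- **The subtorus `Y_N = Φ(W)/(Λ ∩ W)`, `W = N ⊗ ℝ`, as an object of the isogeny category** (period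
isomorphism `subtorusPeriod`, lattice basis adapted to `W ∩ Λ`). [cite: Lange2023AbelianVarietiesComplex, §1.1.6 Exercise (2)(a), p. 26]
[cite: LangeBirkenhake1992, §1.1 Exercise (2)(a)] -/
abbrev subObj : TorusIsogenyCat :=
  of (subtorusPeriod X.Φ (realSpan N) (isLatticeSubspace_realSpan N) hNc)

/-- **The embedding `ι_W = ρ(C) : Y_N ↪ X`** as a morphism of the isogeny category.
[cite: Lange2023AbelianVarietiesComplex, §1.1.2 Prop. 1.1.6 and §1.1.6 Exercise (2)(a)] -/
def subIncl : subObj X N hNc ⟶ X :=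
  ⟨(subtorusMatrix (realSpan N)).map (Int.cast : ℤ → ℚ),
    subtorusMatrix_mem_homRat (realSpan N) X.Φ (isLatticeSubspace_realSpan N) hNc⟩

/-- The matrix of `ι_W` is `C`. [cite: Lange2023AbelianVarietiesComplex, §1.1.6 Exercise (2)(a)] -/
@[simp] theorem subIncl_val :
    (subIncl X N hNc).1 = (subtorusMatrix (realSpan N)).map (Int.cast : ℤ → ℚ) := rfl

/-- **`ι_W : Y_N ↪ X` is a monomorphism** (`R C = 1`). [cite: Lange2023AbelianVarietiesComplex, §1.4.1 Prop. 1.4.2 (proof), p. 43] -/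
instance mono_subIncl : Mono (subIncl X N hNc) := ⟨fun g₁ g₂ h ↦ hom_ext (by
  have h' : (retractionMatrix (realSpan N)).map (Int.cast : ℤ → ℚ) * (g₁ ≫ subIncl X N hNc).1 =
      (retractionMatrix (realSpan N)).map (Int.cast : ℤ → ℚ) * (g₂ ≫ subIncl X N hNc).1 := by rw [h]
  rwa [comp_val, comp_val, subIncl_val, ← Matrix.mul_assoc, ← Matrix.mul_assoc,
    retractionMatrix_mul_subtorusMatrix_rat, Matrix.one_mul, Matrix.one_mul] at h')⟩

/-- **The quotient torus `X/Y_N`** as an object of the isogeny category (period isomorphism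
`quotientTorusPeriod`). [cite: Lange2023AbelianVarietiesComplex, §1.5.4 (`X̄ = X/K(L)⁰`), p. 58]
[cite: Lange2023AbelianVarietiesComplex, §1.4.1 Prop. 1.4.2] -/
abbrev quotObj : TorusIsogenyCat :=
  of (quotientTorusPeriod X.Φ (realSpan N) (isLatticeSubspace_realSpan N) hNc)

/-- **The projection `p_W = ρ(Q) : X ↠ X/Y_N`** as a morphism of the isogeny category.
[cite: Lange2023AbelianVarietiesComplex, §1.5.4, p. 58] -/
def quotProj : X ⟶ quotObj X N hNc :=
  ⟨(quotientTorusMatrix (realSpan N)).map (Int.cast : ℤ → ℚ),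
    quotientTorusMatrix_mem_homRat (realSpan N) X.Φ (isLatticeSubspace_realSpan N) hNc⟩

/-- The matrix of `p_W` is `Q`. [cite: Lange2023AbelianVarietiesComplex, §1.5.4, p. 58] -/
@[simp] theorem quotProj_val :
    (quotProj X N hNc).1 = (quotientTorusMatrix (realSpan N)).map (Int.cast : ℤ → ℚ) := rfl

/-- **`p_W : X ↠ X/Y_N` is an epimorphism** (`Q S = 1`). [cite: Lange2023AbelianVarietiesComplex, §1.4.1 Prop. 1.4.2 (proof), p. 43] -/
instance epi_quotProj : Epi (quotProj X N hNc) := ⟨fun g₁ g₂ h ↦ hom_ext (by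
  have h' : (quotProj X N hNc ≫ g₁).1 * (sectionMatrix (realSpan N)).map (Int.cast : ℤ → ℚ) =
      (quotProj X N hNc ≫ g₂).1 * (sectionMatrix (realSpan N)).map (Int.cast : ℤ → ℚ) := by rw [h]
  rwa [comp_val, comp_val, quotProj_val, Matrix.mul_assoc, Matrix.mul_assoc,
    quotientTorusMatrix_mul_sectionMatrix_rat, Matrix.mul_one, Matrix.mul_one] at h')⟩

/-- **`p_W ∘ ι_W = 0`** (`Q C = 0`). [cite: Lange2023AbelianVarietiesComplex, §1.4.1 Prop. 1.4.2, p. 43] -/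
@[simp] theorem subIncl_comp_quotProj : subIncl X N hNc ≫ quotProj X N hNc = 0 :=
  hom_ext (by rw [comp_val, subIncl_val, quotProj_val, zero_val, quotientTorusMatrix_mul_subtorusMatrix_rat])

/-- **`rk Λ_{Y_N} = dim_ℚ N`** (`= dim_ℝ W`). [cite: Lange2023AbelianVarietiesComplex, §1.1.6 Exercise (2)(a) ("of rank `2g′`"), p. 26] -/
theorem card_subObj_ι : Fintype.card (subObj X N hNc).ι = finrank ℚ N := by
  rw [← finrank_realSpan N, finrank_eq_subRank (isLatticeSubspace_realSpan N)]
  exact Fintype.card_fin _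

/-! ## §2 Kernels and cokernels -/

/-- **`C (R g) = g` for a rational matrix `g` with columns in `N = im C_ℚ`** (`R C = 1`).
[cite: Lange2023AbelianVarietiesComplex, §1.4.1 Prop. 1.4.2 (proof), p. 43] -/
theorem subtorusMatrix_mul_retractionMatrix_mul_eq {κ : Type*} {g : Matrix X.ι κ ℚ} [Fintype κ] [DecidableEq κ]
    (hg : LinearMap.range g.mulVecLin ≤ N) :
    (subtorusMatrix (realSpan N)).map (Int.cast : ℤ → ℚ) *
      ((retractionMatrix (realSpan N)).map (Int.cast : ℤ → ℚ) * g) = g := by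
  refine eq_of_mulVec_eq fun v ↦ ?_
  obtain ⟨u, hu⟩ : g *ᵥ v ∈ LinearMap.range ((subtorusMatrix (realSpan N)).map (Int.cast : ℤ → ℚ)).mulVecLin := by
    rw [range_subtorusMatrix_rat_mulVecLin]
    exact hg ⟨v, rfl⟩
  rw [Matrix.mulVecLin_apply] at hu
  rw [← Matrix.mulVec_mulVec, ← Matrix.mulVec_mulVec, ← hu, Matrix.mulVec_mulVec u,
    retractionMatrix_mul_subtorusMatrix_rat, Matrix.one_mulVec]

variable {X N} in
/-- **`R ρ_r(g) ∈ Hom_ℚ(Z, Y_N)` for `g : Z → X` with image in `Y_N`**: a homomorphism into `X` whose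
rational representation lands in `N` factors through the subtorus (`g = ι_W ∘ ρ(R g)`).
[cite: Lange2023AbelianVarietiesComplex, §1.4.1 Prop. 1.4.2 (proof), p. 43] [cite: Lange2023AbelianVarietiesComplex, §1.1.2 Prop. 1.1.6] -/
theorem retractionMatrix_mul_mem_homRat {Z : TorusIsogenyCat} (g : Z ⟶ X)
    (hg : LinearMap.range g.1.mulVecLin ≤ N) :
    (retractionMatrix (realSpan N)).map (Int.cast : ℤ → ℚ) * g.1 ∈ homRat Z.Φ (subObj X N hNc).Φ := by
  have hg' := (mem_homRat_iff _ _ _).1 g.2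
  have hC := (mem_homRat_iff _ _ _).1 (subIncl X N hNc).2
  rw [subIncl_val] at hC
  have hRC : ((retractionMatrix (realSpan N)).map (Int.cast : ℤ → ℚ)).map (Rat.cast : ℚ → ℝ) *
      ((subtorusMatrix (realSpan N)).map (Int.cast : ℤ → ℚ)).map (Rat.cast : ℚ → ℝ) = 1 := by
    rw [← map_ratCast_mul', retractionMatrix_mul_subtorusMatrix_rat, map_ratCast_one']
  have hCRg : ((subtorusMatrix (realSpan N)).map (Int.cast : ℤ → ℚ)).map (Rat.cast : ℚ → ℝ) *
      (((retractionMatrix (realSpan N)).map (Int.cast : ℤ → ℚ)).map (Rat.cast : ℚ → ℝ) *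
        g.1.map (Rat.cast : ℚ → ℝ)) = g.1.map (Rat.cast : ℚ → ℝ) := by
    rw [← map_ratCast_mul', ← map_ratCast_mul', subtorusMatrix_mul_retractionMatrix_mul_eq X N hg]
  rw [mem_homRat_iff, map_ratCast_mul']
  set R' := ((retractionMatrix (realSpan N)).map (Int.cast : ℤ → ℚ)).map (Rat.cast : ℚ → ℝ)
  set C' := ((subtorusMatrix (realSpan N)).map (Int.cast : ℤ → ℚ)).map (Rat.cast : ℚ → ℝ)
  set g' := g.1.map (Rat.cast : ℚ → ℝ)
  calc R' * g' * jMatrix Z.Φ = R' * (jMatrix X.Φ * g') := by rw [Matrix.mul_assoc, hg']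
    _ = R' * (jMatrix X.Φ * (C' * (R' * g'))) := by rw [hCRg]
    _ = R' * (jMatrix X.Φ * C') * (R' * g') := by simp only [Matrix.mul_assoc]
    _ = R' * (C' * jMatrix (subObj X N hNc).Φ) * (R' * g') := by rw [hC]
    _ = R' * C' * jMatrix (subObj X N hNc).Φ * (R' * g') := by simp only [Matrix.mul_assoc]
    _ = jMatrix (subObj X N hNc).Φ * (R' * g') := by rw [hRC, Matrix.one_mul]

variable {X N} in
/-- `ι_W ∘ – = 0` on... rather: **`f ∘ ι_W = 0` whenever `N ⊆ ker ρ_r(f)`.** [cite: Lange2023AbelianVarietiesComplex, §1.1.2 Prop. 1.1.10, p. 21] -/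
theorem subIncl_comp_eq_zero {X' : TorusIsogenyCat} (f : X ⟶ X') (hN : N ≤ LinearMap.ker f.1.mulVecLin) :
    subIncl X N hNc ≫ f = 0 := hom_ext (by
  rw [comp_val, zero_val, subIncl_val]
  refine eq_of_mulVec_eq fun v ↦ ?_
  rw [← Matrix.mulVec_mulVec, Matrix.zero_mulVec]
  have hv : (subtorusMatrix (realSpan N)).map (Int.cast : ℤ → ℚ) *ᵥ v ∈ N :=
    (range_subtorusMatrix_rat_mulVecLin N).le ⟨v, rfl⟩
  exact hN hv)

variable {X N} in
/-- **`Y_N ↪ X` IS THE KERNEL, in the isogeny category, of every `f : X → X′` with `ker ρ_r(f) = N`**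
(`(Ker f)⁰ = Y_{ker ρ_r(f)}`; a morphism `g : Z → X` with `f g = 0` factors uniquely as `ι_W ∘ ρ(R g)`).
[cite: Lange2023AbelianVarietiesComplex, §1.1.2 Prop. 1.1.10 and §1.4.1 Prop. 1.4.2, pp. 21, 43] [cite: MilneAV2008, §8] -/
def isLimitKernelForkOfKerEq {X' : TorusIsogenyCat} (f : X ⟶ X') (hN : LinearMap.ker f.1.mulVecLin = N) :
    IsLimit (KernelFork.ofι (subIncl X N hNc) (subIncl_comp_eq_zero hNc f hN.ge)) :=
  Fork.IsLimit.mk' _ fun s ↦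
    have hs : LinearMap.range s.ι.1.mulVecLin ≤ N := by
      rintro _ ⟨v, rfl⟩
      rw [← hN, LinearMap.mem_ker, Matrix.mulVecLin_apply, Matrix.mulVecLin_apply, Matrix.mulVec_mulVec,
        ← comp_val, KernelFork.condition, zero_val, Matrix.zero_mulVec]
    have hfac : (⟨_, retractionMatrix_mul_mem_homRat hNc s.ι hs⟩ : s.pt ⟶ subObj X N hNc) ≫
        subIncl X N hNc = s.ι :=
      hom_ext (by rw [comp_val, subIncl_val]; exact subtorusMatrix_mul_retractionMatrix_mul_eq X N hs)
    ⟨⟨_, retractionMatrix_mul_mem_homRat hNc s.ι hs⟩, by rw [Fork.ι_ofι]; exact hfac,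
      fun {m} hm ↦ by
        rw [Fork.ι_ofι] at hm
        exact (cancel_mono (subIncl X N hNc)).1 (hm.trans hfac.symm)⟩

variable {X} in
/-- **The kernel of (the rational representation of) a homomorphism spans a complex lattice subspace**
(`(Ker f)⁰` is a complex subtorus). [cite: Lange2023AbelianVarietiesComplex, §1.1.2 Prop. 1.1.6 and Prop. 1.1.10] -/
theorem isComplexSubspace_realSpan_ker {X' : TorusIsogenyCat} (f : X ⟶ X') :
    IsComplexSubspace X.Φ (realSpan (LinearMap.ker f.1.mulVecLin)) := by
  obtain ⟨F, hF⟩ := (mem_homRat_iff_exists_analyticRep X.Φ X'.Φ f.1).1 f.2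
  rw [← ker_mulVecLin_map_ratCast]
  exact isComplexSubspace_ker_of_analyticRep X.Φ X'.Φ hF

variable {X} in
/-- **The image of (the rational representation of) a homomorphism spans a complex lattice subspace**
(`Im f` is a complex subtorus). [cite: Lange2023AbelianVarietiesComplex, §1.1.2 Prop. 1.1.6 and Prop. 1.1.10] -/
theorem isComplexSubspace_realSpan_range {X' : TorusIsogenyCat} (f : X' ⟶ X) :
    IsComplexSubspace X.Φ (realSpan (LinearMap.range f.1.mulVecLin)) := by
  obtain ⟨F, hF⟩ := (mem_homRat_iff_exists_analyticRep X'.Φ X.Φ f.1).1 f.2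
  rw [← range_mulVecLin_map_ratCast]
  exact isComplexSubspace_range_of_analyticRep X'.Φ X.Φ hF

variable {X} in
/-- **`(Ker f)⁰` as an object of the isogeny category**: the subtorus of `X` on `ker ρ_r(f) ⊗ ℝ`.
[cite: Lange2023AbelianVarietiesComplex, §1.1.2 Prop. 1.1.10, p. 21] -/
abbrev kerObj {X' : TorusIsogenyCat} (f : X ⟶ X') : TorusIsogenyCat :=
  subObj X (LinearMap.ker f.1.mulVecLin) (isComplexSubspace_realSpan_ker f)

variable {X} in
/-- The embedding `(Ker f)⁰ ↪ X`. [cite: Lange2023AbelianVarietiesComplex, §1.1.2 Prop. 1.1.10, p. 21] -/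
abbrev kerIncl {X' : TorusIsogenyCat} (f : X ⟶ X') : kerObj f ⟶ X :=
  subIncl X (LinearMap.ker f.1.mulVecLin) (isComplexSubspace_realSpan_ker f)

variable {X} in
/-- `f ∘ ((Ker f)⁰ ↪ X) = 0`. [cite: Lange2023AbelianVarietiesComplex, §1.1.2 Prop. 1.1.10, p. 21] -/
theorem kerIncl_comp {X' : TorusIsogenyCat} (f : X ⟶ X') : kerIncl f ≫ f = 0 :=
  subIncl_comp_eq_zero _ f le_rfl

variable {X} in
/-- `(Ker f)⁰ ↪ X` is a limit kernel fork. [cite: Lange2023AbelianVarietiesComplex, §1.1.2 Prop. 1.1.10] [cite: MilneAV2008, §8] -/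
def kernelIsLimit {X' : TorusIsogenyCat} (f : X ⟶ X') : IsLimit (KernelFork.ofι (kerIncl f) (kerIncl_comp f)) :=
  isLimitKernelForkOfKerEq _ f rfl

variable {X} in
/-- **`Ker(f) ≅ (Ker f)⁰` IN THE ISOGENY CATEGORY**: the (abstract) kernel of `f` in the abelian category
`TorusIsogenyCat` is the identity component of the kernel, the subtorus on `ker ρ_r(f) ⊗ ℝ`.
[cite: Lange2023AbelianVarietiesComplex, §1.1.2 Prop. 1.1.10, p. 21] [cite: MilneAV2008, §8] [cite: MumfordAV1970, §19, p. 174] -/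
def kernelIsoKerObj {X' : TorusIsogenyCat} (f : X ⟶ X') : kernel f ≅ kerObj f :=
  IsLimit.conePointUniqueUpToIso (kernelIsKernel f) (kernelIsLimit f)

variable {X} in
/-- Compatibility of `Ker(f) ≅ (Ker f)⁰` with the two embeddings into `X`. [cite: Lange2023AbelianVarietiesComplex, §1.1.2 Prop. 1.1.10] -/
@[reassoc (attr := simp)]
theorem kernelIsoKerObj_inv_ι {X' : TorusIsogenyCat} (f : X ⟶ X') :
    (kernelIsoKerObj f).inv ≫ kernel.ι f = kerIncl f :=
  IsLimit.conePointUniqueUpToIso_inv_comp (kernelIsKernel f) (kernelIsLimit f) WalkingParallelPair.zero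

variable {X} in
/-- Compatibility of `Ker(f) ≅ (Ker f)⁰` with the two embeddings into `X`. [cite: Lange2023AbelianVarietiesComplex, §1.1.2 Prop. 1.1.10] -/
@[reassoc (attr := simp)]
theorem kernelIsoKerObj_hom_kerIncl {X' : TorusIsogenyCat} (f : X ⟶ X') :
    (kernelIsoKerObj f).hom ≫ kerIncl f = kernel.ι f := by
  rw [← kernelIsoKerObj_inv_ι, Iso.hom_inv_id_assoc]

/-- **`p S Q = p` for a rational matrix `p` vanishing on `N = ker Q_ℚ`** (`S Q = 1 - C R`, `p C = 0`).
[cite: Lange2023AbelianVarietiesComplex, §1.4.1 Prop. 1.4.2 (proof), p. 43] -/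
theorem mul_sectionMatrix_mul_quotientTorusMatrix_eq {κ : Type*} [Fintype κ] [DecidableEq κ] {p : Matrix κ X.ι ℚ}
    (hp : N ≤ LinearMap.ker p.mulVecLin) :
    p * (sectionMatrix (realSpan N)).map (Int.cast : ℤ → ℚ) *
      (quotientTorusMatrix (realSpan N)).map (Int.cast : ℤ → ℚ) = p := by
  have hpC : p * (subtorusMatrix (realSpan N)).map (Int.cast : ℤ → ℚ) = 0 := by
    refine eq_of_mulVec_eq fun v ↦ ?_
    rw [← Matrix.mulVec_mulVec, Matrix.zero_mulVec]
    have hv : (subtorusMatrix (realSpan N)).map (Int.cast : ℤ → ℚ) *ᵥ v ∈ N :=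
      (range_subtorusMatrix_rat_mulVecLin N).le ⟨v, rfl⟩
    exact hp hv
  rw [Matrix.mul_assoc, sectionMatrix_mul_quotientTorusMatrix_rat, Matrix.mul_sub, Matrix.mul_one,
    ← Matrix.mul_assoc, hpC, Matrix.zero_mul, sub_zero]

variable {X N} in
/-- **`ρ_r(p) S ∈ Hom_ℚ(X/Y_N, Z)` for `p : X → Z` vanishing on `Y_N`**: a homomorphism out of `X` that
kills `N` factors through the quotient torus (`p = ρ(p S) ∘ p_W`). [cite: Lange2023AbelianVarietiesComplex, §1.4.1 Prop. 1.4.2 (proof), p. 43]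
[cite: Lange2023AbelianVarietiesComplex, §1.1.2 Prop. 1.1.6] -/
theorem mul_sectionMatrix_mem_homRat {Z : TorusIsogenyCat} (p : X ⟶ Z) (hp : N ≤ LinearMap.ker p.1.mulVecLin) :
    p.1 * (sectionMatrix (realSpan N)).map (Int.cast : ℤ → ℚ) ∈ homRat (quotObj X N hNc).Φ Z.Φ := by
  have hp' := (mem_homRat_iff _ _ _).1 p.2
  have hQ := (mem_homRat_iff _ _ _).1 (quotProj X N hNc).2
  rw [quotProj_val] at hQ
  have hQS : ((quotientTorusMatrix (realSpan N)).map (Int.cast : ℤ → ℚ)).map (Rat.cast : ℚ → ℝ) *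
      ((sectionMatrix (realSpan N)).map (Int.cast : ℤ → ℚ)).map (Rat.cast : ℚ → ℝ) = 1 := by
    rw [← map_ratCast_mul', quotientTorusMatrix_mul_sectionMatrix_rat, map_ratCast_one']
  have hpSQ : p.1.map (Rat.cast : ℚ → ℝ) * ((sectionMatrix (realSpan N)).map (Int.cast : ℤ → ℚ)).map (Rat.cast : ℚ → ℝ) *
      ((quotientTorusMatrix (realSpan N)).map (Int.cast : ℤ → ℚ)).map (Rat.cast : ℚ → ℝ) =
        p.1.map (Rat.cast : ℚ → ℝ) := by
    rw [← map_ratCast_mul', ← map_ratCast_mul', mul_sectionMatrix_mul_quotientTorusMatrix_eq X N hp]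
  rw [mem_homRat_iff, map_ratCast_mul']
  set S' := ((sectionMatrix (realSpan N)).map (Int.cast : ℤ → ℚ)).map (Rat.cast : ℚ → ℝ)
  set Q' := ((quotientTorusMatrix (realSpan N)).map (Int.cast : ℤ → ℚ)).map (Rat.cast : ℚ → ℝ)
  set p' := p.1.map (Rat.cast : ℚ → ℝ)
  calc p' * S' * jMatrix (quotObj X N hNc).Φ = p' * S' * jMatrix (quotObj X N hNc).Φ * (Q' * S') := by
        rw [hQS, Matrix.mul_one]
    _ = p' * S' * (jMatrix (quotObj X N hNc).Φ * Q') * S' := by simp only [Matrix.mul_assoc]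
    _ = p' * S' * (Q' * jMatrix X.Φ) * S' := by rw [hQ]
    _ = p' * S' * Q' * jMatrix X.Φ * S' := by simp only [Matrix.mul_assoc]
    _ = jMatrix Z.Φ * p' * S' := by rw [hpSQ, hp']
    _ = jMatrix Z.Φ * (p' * S') := by rw [Matrix.mul_assoc]

variable {X N} in
/-- **`p_W ∘ f = 0` whenever `im ρ_r(f) ⊆ N`.** [cite: Lange2023AbelianVarietiesComplex, §1.4.1 Prop. 1.4.2, p. 43] -/
theorem comp_quotProj_eq_zero {X' : TorusIsogenyCat} (f : X' ⟶ X) (hN : LinearMap.range f.1.mulVecLin ≤ N) :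
    f ≫ quotProj X N hNc = 0 := hom_ext (by
  rw [comp_val, zero_val, quotProj_val]
  refine eq_of_mulVec_eq fun v ↦ ?_
  rw [← Matrix.mulVec_mulVec, Matrix.zero_mulVec]
  have hv : f.1 *ᵥ v ∈ LinearMap.ker ((quotientTorusMatrix (realSpan N)).map (Int.cast : ℤ → ℚ)).mulVecLin := by
    rw [ker_quotientTorusMatrix_rat_mulVecLin]
    exact hN ⟨v, rfl⟩
  exact hv)

variable {X N} in
/-- **`X ↠ X/Y_N` IS THE COKERNEL, in the isogeny category, of every `f : X′ → X` with `im ρ_r(f) = N`**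
(`Coker f = X/Im f`; a morphism `p : X → Z` with `p f = 0` factors uniquely as `ρ(p S) ∘ p_W`).
[cite: Lange2023AbelianVarietiesComplex, §1.4.1 Prop. 1.4.2, p. 43] [cite: MilneAV2008, §8] -/
def isColimitCokernelCoforkOfRangeEq {X' : TorusIsogenyCat} (f : X' ⟶ X) (hN : LinearMap.range f.1.mulVecLin = N) :
    IsColimit (CokernelCofork.ofπ (quotProj X N hNc) (comp_quotProj_eq_zero hNc f hN.le)) :=
  Cofork.IsColimit.mk' _ fun s ↦
    have hs : N ≤ LinearMap.ker s.π.1.mulVecLin := by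
      rw [← hN]
      rintro _ ⟨v, rfl⟩
      rw [LinearMap.mem_ker, Matrix.mulVecLin_apply, Matrix.mulVecLin_apply, Matrix.mulVec_mulVec, ← comp_val,
        CokernelCofork.condition, zero_val, Matrix.zero_mulVec]
    have hfac : quotProj X N hNc ≫
        (⟨_, mul_sectionMatrix_mem_homRat hNc s.π hs⟩ : quotObj X N hNc ⟶ s.pt) = s.π :=
      hom_ext (by rw [comp_val, quotProj_val]; exact mul_sectionMatrix_mul_quotientTorusMatrix_eq X N hs)
    ⟨⟨_, mul_sectionMatrix_mem_homRat hNc s.π hs⟩, by rw [Cofork.π_ofπ]; exact hfac,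
      fun {m} hm ↦ by
        rw [Cofork.π_ofπ] at hm
        exact (cancel_epi (quotProj X N hNc)).1 (hm.trans hfac.symm)⟩

variable {X} in
/-- **`X/Im f` as an object of the isogeny category**: the quotient torus of `X` by the complex subtorus
on `im ρ_r(f) ⊗ ℝ`. [cite: Lange2023AbelianVarietiesComplex, §1.1.2 Prop. 1.1.10 and §1.4.1 Prop. 1.4.2] -/
abbrev cokerObj {X' : TorusIsogenyCat} (f : X' ⟶ X) : TorusIsogenyCat :=
  quotObj X (LinearMap.range f.1.mulVecLin) (isComplexSubspace_realSpan_range f)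

variable {X} in
/-- The projection `X ↠ X/Im f`. [cite: Lange2023AbelianVarietiesComplex, §1.4.1 Prop. 1.4.2] -/
abbrev cokerProj {X' : TorusIsogenyCat} (f : X' ⟶ X) : X ⟶ cokerObj f :=
  quotProj X (LinearMap.range f.1.mulVecLin) (isComplexSubspace_realSpan_range f)

variable {X} in
/-- `(X ↠ X/Im f) ∘ f = 0`. [cite: Lange2023AbelianVarietiesComplex, §1.4.1 Prop. 1.4.2] -/
theorem comp_cokerProj {X' : TorusIsogenyCat} (f : X' ⟶ X) : f ≫ cokerProj f = 0 :=
  comp_quotProj_eq_zero _ f le_rfl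

variable {X} in
/-- `X ↠ X/Im f` is a colimit cokernel cofork. [cite: Lange2023AbelianVarietiesComplex, §1.4.1 Prop. 1.4.2] [cite: MilneAV2008, §8] -/
def cokernelIsColimit {X' : TorusIsogenyCat} (f : X' ⟶ X) :
    IsColimit (CokernelCofork.ofπ (cokerProj f) (comp_cokerProj f)) :=
  isColimitCokernelCoforkOfRangeEq _ f rfl

variable {X} in
/-- **`Coker(f) ≅ X/Im f` IN THE ISOGENY CATEGORY.** [cite: Lange2023AbelianVarietiesComplex, §1.4.1 Prop. 1.4.2] [cite: MilneAV2008, §8]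
[cite: MumfordAV1970, §19, p. 174] -/
def cokernelIsoCokerObj {X' : TorusIsogenyCat} (f : X' ⟶ X) : cokernel f ≅ cokerObj f :=
  IsColimit.coconePointUniqueUpToIso (cokernelIsCokernel f) (cokernelIsColimit f)

variable {X} in
/-- Compatibility of `Coker(f) ≅ X/Im f` with the two projections from `X`. [cite: Lange2023AbelianVarietiesComplex, §1.4.1 Prop. 1.4.2] -/
@[reassoc (attr := simp)]
theorem π_cokernelIsoCokerObj_hom {X' : TorusIsogenyCat} (f : X' ⟶ X) :
    cokernel.π f ≫ (cokernelIsoCokerObj f).hom = cokerProj f :=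
  IsColimit.comp_coconePointUniqueUpToIso_hom (cokernelIsCokernel f) (cokernelIsColimit f) WalkingParallelPair.one

/-- **`0 → Y_N → X → X/Y_N → 0`** as a short complex of the isogeny category.
[cite: Lange2023AbelianVarietiesComplex, §1.4.1 Prop. 1.4.2, p. 43] -/
abbrev subQuotShortComplex : ShortComplex TorusIsogenyCat :=
  ShortComplex.mk (subIncl X N hNc) (quotProj X N hNc) (subIncl_comp_quotProj X N hNc)

/-- **`0 → Y_N → X → X/Y_N → 0` IS A SHORT EXACT SEQUENCE OF THE ABELIAN CATEGORY `TorusIsogenyCat`**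
(Prop. 1.4.2: exact sequences of complex tori; `ι_W` is the kernel of `p_W` since `ker Q_ℚ = N`).
[cite: Lange2023AbelianVarietiesComplex, §1.4.1 Prop. 1.4.2, p. 43] [cite: MilneAV2008, §8] -/
theorem subQuotShortExact : (subQuotShortComplex X N hNc).ShortExact where
  exact := ShortComplex.exact_of_f_is_kernel _
    (isLimitKernelForkOfKerEq hNc (quotProj X N hNc) (ker_quotientTorusMatrix_rat_mulVecLin N))

end SubQuot

/-! ## §3 Monomorphisms and epimorphisms of the isogeny category -/

/-- **`f` is a MONOMORPHISM of the isogeny category iff `ker ρ_r(f) = 0`** (iff `f` has finite kernel,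
i.e. `(Ker f)⁰ = 0`). [cite: Lange2023AbelianVarietiesComplex, §1.1.2 Prop. 1.1.10 (b) and §1.2.6, p. 21]
[cite: MilneAV2008, §8] -/
theorem mono_iff_ker_eq_bot {X X' : TorusIsogenyCat} (f : X ⟶ X') :
    Mono f ↔ LinearMap.ker f.1.mulVecLin = ⊥ := by
  constructor
  · intro hf
    have h0 : kerIncl f = 0 := (cancel_mono f).1 (by rw [kerIncl_comp, zero_comp])
    have hC : (subtorusMatrix (realSpan (LinearMap.ker f.1.mulVecLin))).map (Int.cast : ℤ → ℚ) = 0 :=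
      congrArg Subtype.val h0
    rw [← range_subtorusMatrix_rat_mulVecLin (LinearMap.ker f.1.mulVecLin), hC, Matrix.mulVecLin_zero,
      LinearMap.range_zero]
  · intro h
    refine ⟨fun g₁ g₂ hfg ↦ hom_ext (eq_of_mulVec_eq fun v ↦ LinearMap.ker_eq_bot.1 h ?_)⟩
    rw [Matrix.mulVecLin_apply, Matrix.mulVecLin_apply, Matrix.mulVec_mulVec, Matrix.mulVec_mulVec,
      ← comp_val, ← comp_val, hfg]

/-- **`f` is an EPIMORPHISM of the isogeny category iff `ρ_r(f)` is surjective** (iff `f` is surjective,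
i.e. `X′/Im f = 0`). [cite: Lange2023AbelianVarietiesComplex, §1.1.2 Prop. 1.1.10 and §1.2.6]
[cite: MilneAV2008, §8] -/
theorem epi_iff_range_eq_top {X' X : TorusIsogenyCat} (f : X' ⟶ X) :
    Epi f ↔ LinearMap.range f.1.mulVecLin = ⊤ := by
  constructor
  · intro hf
    have h0 : cokerProj f = 0 := (cancel_epi f).1 (by rw [comp_cokerProj, comp_zero])
    have hQ : (quotientTorusMatrix (realSpan (LinearMap.range f.1.mulVecLin))).map (Int.cast : ℤ → ℚ) = 0 :=
      congrArg Subtype.val h0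
    rw [← ker_quotientTorusMatrix_rat_mulVecLin (LinearMap.range f.1.mulVecLin), hQ, Matrix.mulVecLin_zero,
      LinearMap.ker_zero]
  · intro h
    refine ⟨fun g₁ g₂ hfg ↦ hom_ext (eq_of_mulVec_eq fun w ↦ ?_)⟩
    obtain ⟨v, rfl⟩ := LinearMap.range_eq_top.1 h w
    rw [Matrix.mulVecLin_apply, Matrix.mulVec_mulVec, Matrix.mulVec_mulVec, ← comp_val, ← comp_val, hfg]

/-- **The zero objects of the isogeny category are the tori of dimension `0`** (`rk Λ = 0`).
[cite: Lange2023AbelianVarietiesComplex, §1.1.2, p. 20] -/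
theorem isZero_iff_isEmpty (X : TorusIsogenyCat) : IsZero X ↔ IsEmpty X.ι := by
  refine ⟨fun h ↦ ?_, fun _ ↦ isZero_of_isEmpty X⟩
  by_contra hne
  rw [not_isEmpty_iff] at hne
  obtain ⟨i⟩ := hne
  have h1 : (1 : Matrix X.ι X.ι ℚ) = 0 := by rw [← id_val X, h.eq_of_src (𝟙 X) 0, zero_val]
  have h11 := congrFun (congrFun h1 i) i
  rw [Matrix.one_apply_eq, Matrix.zero_apply] at h11
  exact one_ne_zero h11

/-! ## §4 The simple objects of the isogeny category are the simple tori -/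

section SimpleObjects

variable (X : TorusIsogenyCat)

/-- The embedding of a NONZERO subtorus is a nonzero morphism. [cite: Lange2023AbelianVarietiesComplex, §1.1.6 Exercise (2)(a)] -/
theorem subIncl_ne_zero {N : Submodule ℚ (X.ι → ℚ)} (hNc : IsComplexSubspace X.Φ (realSpan N)) (hN : N ≠ ⊥) :
    subIncl X N hNc ≠ 0 := fun h ↦ hN (by
  have hC : (subtorusMatrix (realSpan N)).map (Int.cast : ℤ → ℚ) = 0 := congrArg Subtype.val h
  rw [← range_subtorusMatrix_rat_mulVecLin N, hC, Matrix.mulVecLin_zero, LinearMap.range_zero])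

/-- `N ⊗ ℝ = 0 ⟹ N = 0`. [folklore] -/
private theorem eq_bot_of_realSpan_eq_bot {N : Submodule ℚ (X.ι → ℚ)} (h : realSpan N = ⊥) : N = ⊥ := by
  rw [← Submodule.finrank_eq_zero, ← finrank_realSpan N, h, finrank_bot]

/-- `N ⊗ ℝ = ℝ^ι ⟹ N = ℚ^ι`. [folklore] -/
private theorem eq_top_of_realSpan_eq_top {N : Submodule ℚ (X.ι → ℚ)} (h : realSpan N = ⊤) : N = ⊤ :=
  Submodule.eq_top_of_finrank_eq (by
    rw [← finrank_realSpan N, h, finrank_top, finrank_fintype_fun_eq_card, finrank_fintype_fun_eq_card])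

/-- **A simple object of the isogeny category is a simple torus**: a nonzero complex subtorus `Y_N ↪ X`
is a nonzero monomorphism, hence an isomorphism, hence of full rank. [cite: Lange2023AbelianVarietiesComplex, §2.4.4, p. 123 ("simple")]
[cite: LangeBirkenhake1992, §1.1 Exercise (2)(a)] -/
theorem isSimple_of_simple [Simple X] : IsSimple X.Φ := by
  intro W hW hWc
  obtain ⟨N, rfl⟩ := hW.exists_eq_realSpan
  by_cases hN : N = ⊥
  · left
    rw [hN, ← Submodule.finrank_eq_zero, finrank_realSpan, finrank_bot]
  · right
    haveI : IsIso (subIncl X N hWc) := isIso_of_mono_of_nonzero (subIncl_ne_zero X hWc hN)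
    have hcard : Fintype.card (Fin (subRank (realSpan N))) = Fintype.card X.ι :=
      (isIsogenous_of_iso (asIso (subIncl X N hWc))).card_eq
    apply Submodule.eq_top_of_finrank_eq
    rw [finrank_fintype_fun_eq_card, ← hcard, Fintype.card_fin, finrank_eq_subRank (isLatticeSubspace_realSpan N)]

variable {X} in
/-- **The inverse of a morphism whose rational representation is bijective** (Lemma 1.1.11 / Prop. 1.2.6 in
the isogeny category: "an isogeny is invertible in `Hom_ℚ`"). [cite: Lange2023AbelianVarietiesComplex, §1.2.6 Prop. 1.2.6, p. 29] -/
theorem isIso_of_bijective {Y : TorusIsogenyCat} (f : Y ⟶ X) (hf : Bijective f.1.mulVecLin) : IsIso f := by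
  let e : (Y.ι → ℚ) ≃ₗ[ℚ] (X.ι → ℚ) := LinearEquiv.ofBijective f.1.mulVecLin hf
  let B : Matrix Y.ι X.ι ℚ := LinearMap.toMatrix' e.symm.toLinearMap
  have hBv : ∀ w, B *ᵥ w = e.symm w := fun w ↦ by
    rw [← Matrix.toLin'_apply, Matrix.toLin'_toMatrix']
    rfl
  have hBf : B * f.1 = 1 := eq_of_mulVec_eq fun v ↦ by
    rw [← Matrix.mulVec_mulVec, Matrix.one_mulVec, hBv]
    exact e.symm_apply_apply v
  have hfB : f.1 * B = 1 := eq_of_mulVec_eq fun w ↦ by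
    rw [← Matrix.mulVec_mulVec, Matrix.one_mulVec, hBv]
    exact e.apply_symm_apply w
  have hB : B ∈ homRat X.Φ Y.Φ := by
    have hf' := (mem_homRat_iff _ _ _).1 f.2
    have h1 : B.map (Rat.cast : ℚ → ℝ) * f.1.map (Rat.cast : ℚ → ℝ) = 1 := by
      rw [← map_ratCast_mul', hBf, map_ratCast_one']
    have h2 : f.1.map (Rat.cast : ℚ → ℝ) * B.map (Rat.cast : ℚ → ℝ) = 1 := by
      rw [← map_ratCast_mul', hfB, map_ratCast_one']
    rw [mem_homRat_iff]
    set B' := B.map (Rat.cast : ℚ → ℝ)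
    set f' := f.1.map (Rat.cast : ℚ → ℝ)
    calc B' * jMatrix X.Φ = B' * jMatrix X.Φ * (f' * B') := by rw [h2, Matrix.mul_one]
      _ = B' * (jMatrix X.Φ * f') * B' := by simp only [Matrix.mul_assoc]
      _ = B' * (f' * jMatrix Y.Φ) * B' := by rw [hf']
      _ = B' * f' * jMatrix Y.Φ * B' := by simp only [Matrix.mul_assoc]
      _ = jMatrix Y.Φ * B' := by rw [h1, Matrix.one_mul]
  exact ⟨⟨B, hB⟩, hom_ext (by rw [comp_val, id_val]; exact hBf), hom_ext (by rw [comp_val, id_val]; exact hfB)⟩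

/-- **A simple torus is a simple object of the isogeny category**: a nonzero monomorphism `f : Y ↪ X` has
image a nonzero complex subtorus `Im f = X`, so `ρ_r(f)` is bijective and `f` is an isomorphism.
[cite: Lange2023AbelianVarietiesComplex, §2.4.4 Cor. 2.4.26 (proof), p. 124] [cite: MumfordAV1970, §19 Cor. 2, p. 174] -/
theorem simple_of_isSimple [Nonempty X.ι] (hX : IsSimple X.Φ) : Simple X where
  mono_isIso_iff_nonzero {Y} f hf := by
    refine ⟨fun hiso hf0 ↦ ?_, fun hf0 ↦ ?_⟩
    · have h1 : (1 : Matrix X.ι X.ι ℚ) = 0 := by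
        rw [← id_val X, ← IsIso.inv_hom_id f, comp_val, show f.1 = 0 from congrArg Subtype.val hf0,
          Matrix.zero_mul]
      obtain ⟨i⟩ := ‹Nonempty X.ι›
      have h11 := congrFun (congrFun h1 i) i
      rw [Matrix.one_apply_eq, Matrix.zero_apply] at h11
      exact one_ne_zero h11
    · rcases hX _ (isLatticeSubspace_realSpan _) (isComplexSubspace_realSpan_range f) with hbot | htop
      · refine absurd (hom_ext ?_) hf0
        rw [zero_val]
        refine eq_of_mulVec_eq fun v ↦ ?_
        rw [Matrix.zero_mulVec]
        have hv : f.1 *ᵥ v ∈ LinearMap.range f.1.mulVecLin := ⟨v, rfl⟩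
        rw [eq_bot_of_realSpan_eq_bot X hbot] at hv
        exact (Submodule.mem_bot ℚ).1 hv
      · exact isIso_of_bijective f ⟨LinearMap.ker_eq_bot.1 ((mono_iff_ker_eq_bot f).1 hf),
          LinearMap.range_eq_top.1 (eq_top_of_realSpan_eq_top X htop)⟩

/-- **THE SIMPLE OBJECTS OF THE ISOGENY CATEGORY OF COMPLEX TORI ARE THE SIMPLE TORI.**
[cite: Lange2023AbelianVarietiesComplex, §2.4.4, p. 123] [cite: LangeBirkenhake1992, §1.1 Exercise (2)(a)] [cite: MumfordAV1970, §19, p. 174] -/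
theorem simple_iff_isSimple [Nonempty X.ι] : Simple X ↔ IsSimple X.Φ :=
  ⟨fun _ ↦ isSimple_of_simple X, simple_of_isSimple X⟩

/-- **Consistency with Isab**: an abelian variety is a simple object of Isab_ℂ iff it is a simple object of
the isogeny category of all tori. [cite: Lange2023AbelianVarietiesComplex, §2.4.4 Cor. 2.4.25, p. 123] -/
theorem Isab.simple_iff_simple_obj (X : Isab) [Nonempty X.obj.ι] : Simple X ↔ Simple X.obj :=
  (Isab.simple_iff_isSimple X).trans (TorusIsogenyCat.simple_iff_isSimple X.obj).symm

end SimpleObjects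

/-! ## §5 Validation -/

/-- **Every elliptic curve is a simple object of the isogeny category of complex tori.**
[cite: Lange2023AbelianVarietiesComplex, §2.4.4, p. 123] -/
theorem simple_elliptic {τ : ℂ} (hτ : 0 < τ.im) : Simple (of (ellipticPeriod hτ.ne')) :=
  haveI : Nonempty (ellipticIsab hτ).obj.ι := ⟨(0 : Fin 2)⟩
  (Isab.simple_iff_simple_obj (ellipticIsab hτ)).1 (simple_ellipticIsab hτ)

/-- **`E_τ × E_σ` is NOT a simple object of the isogeny category.** [cite: Lange2023AbelianVarietiesComplex, §2.4.4, p. 123] -/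
theorem not_simple_prodElliptic {τ σ : ℂ} (hτ : 0 < τ.im) (hσ : 0 < σ.im) :
    ¬ Simple (prodObj (of (ellipticPeriod hτ.ne')) (of (ellipticPeriod hσ.ne'))) := fun h ↦
  haveI : Nonempty (prodEllipticIsab hτ hσ).obj.ι := ⟨Sum.inl (0 : Fin 2)⟩
  not_simple_prodEllipticIsab hτ hσ ((Isab.simple_iff_simple_obj (prodEllipticIsab hτ hσ)).2 h)

/-- **The first inclusion `E_τ ↪ E_τ × E_σ` is a monomorphism** (`ker (1 / 0) = 0`).
[cite: Lange2023AbelianVarietiesComplex, §1.1.2 Prop. 1.1.10] -/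
theorem mono_inlHom_elliptic {τ σ : ℂ} (hτ : 0 < τ.im) (hσ : 0 < σ.im) :
    Mono (inlHom (of (ellipticPeriod hτ.ne')) (of (ellipticPeriod hσ.ne'))) :=
  (mono_iff_ker_eq_bot _).2 (LinearMap.ker_eq_bot.2 fun v w h ↦ by
    rw [Matrix.mulVecLin_apply, Matrix.mulVecLin_apply, inlHom_val, Matrix.fromRows_mulVec,
      Matrix.fromRows_mulVec, Matrix.one_mulVec, Matrix.one_mulVec] at h
    exact funext fun i ↦ by simpa using congrFun h (Sum.inl i))

/-- **… and it is NOT an epimorphism** (its image `E_τ × 0` is a proper subtorus: `ρ_r = (1 / 0)` is not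
surjective). [cite: Lange2023AbelianVarietiesComplex, §1.1.2 Prop. 1.1.10] -/
theorem not_epi_inlHom_elliptic {τ σ : ℂ} (hτ : 0 < τ.im) (hσ : 0 < σ.im) :
    ¬ Epi (inlHom (of (ellipticPeriod hτ.ne')) (of (ellipticPeriod hσ.ne'))) := by
  rw [epi_iff_range_eq_top, inlHom_val]
  intro h
  have hv : (Sum.elim (0 : Fin 2 → ℚ) fun _ ↦ (1 : ℚ)) ∈ LinearMap.range
      (Matrix.fromRows (1 : Matrix (Fin 2) (Fin 2) ℚ) (0 : Matrix (Fin 2) (Fin 2) ℚ)).mulVecLin := by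
    rw [h]; exact Submodule.mem_top
  obtain ⟨v, hv⟩ := hv
  have h0 := congrFun hv (Sum.inr 0)
  rw [Matrix.mulVecLin_apply, Matrix.fromRows_mulVec, Sum.elim_inr, Sum.elim_inr, Matrix.zero_mulVec,
    Pi.zero_apply] at h0
  exact zero_ne_one h0

end TorusIsogenyCat

end Literature.AlgebraicGeometry.HodgeTheory

end
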